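import Summits.ABC.StewartYu.YuNinetyW80TwoTransfer
import HarnessLib

/-!
# Cell abc-stewartyu, rung F-A1 (M3): the TRANSFER at `p = 2` — Gen-3 unit-form engine text ⇒ the
# Yu-2007-quality prime text `Y07Two` (stub `stub_transferTwo` of the staged route `PadicPrimesKummerThird`)

`Summits/ABC/StewartYu/YuOhSevenTransferTwo.lean` — cell `abc-stewartyu` (HOME
`run/shared/lean/pub/abc-stewartyu/`, seat p1-g5; theorems only, no definition, no named fact).  Sibling of
p2's `YuOhSevenTransferOdd.lean` (`YuOhSeven.y07Odd_of_genThreeEngineOdd`).  The hypothesis is the ENGINE text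
`GenThreeEngineTwo` and the conclusion the CRUX text `Y07Two` of the planners' birth skeleton
(HOME/plan-m3/bc/Y07Two_birth.lean, bytes of 2026-08-26T13:01Z) VERBATIM, so that the registered transfer stub
of that line becomes `exact YuOhSeven.y07Two_of_genThreeEngineTwo h` once the route file exists.  Pattern = the
landed M2 transfer `YuNinetyW80.two_of_w80Engine` (`αⱼ = qⱼ²`); the Gen-3 shape differs in three places:
`C(m) ≤ c₁^m` (no `m^m`), ONE logarithm (`log 2 + log B + log log A`), bare `∏ log q`.

`y07Two_of_genThreeEngineTwo`: `αⱼ = qⱼ²` (integers `≡ 1 (mod 8)`, multiplicatively independent, cube-Kummer —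
`three_le_padicValRat_sq_sub_one`, `prime_family_zpow_eq_one`, `not_cube_prod_sq_primes`), `Vⱼ = 2 log qⱼ ≥ 1`
(`qⱼ ≥ 3`), `Vmax = 2 log A` (`A = max(4, max S)`), `W = log B ≥ 1`; `ord₂(u − 1) ≤ ord₂(u² − 1)`; garbage
`W + log 2Vmax = log B + 2 log 2 + log log A ≤ 2·(log 2 + log B + log log A)` and `2^m·2 log 2 < 3^m·(2/log 2)`
⇒ **`c₆ = 3c₁`**.  Everything is [folklore] book-keeping; WHAT THIS IS NOT: no engine is proved here and the
M3 route is not open (no crux moves). [cite: Yu2007, Main Thm (K = ℚ, ℘ = 2); shape only]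
-/

noncomputable section

open Finset Real Height

namespace Summit.ABC.StewartYu

namespace YuOhSeven

open Summit.ABC.ABC.Theorems

/-- `2·log 2 < 2 / log 2`. [folklore] -/
theorem two_mul_log_two_lt_two_div : 2 * Real.log 2 < 2 / Real.log 2 := by
  have h1 := Real.log_two_lt_d9
  have h0 := Real.log_two_gt_d9
  rw [lt_div_iff₀ (by linarith)]
  nlinarith

/-- **Transfer at `p = 2`: the Gen-3 `2`-adic unit-form engine ⇒ the Yu-2007-quality text for sets of
odd primes** (`c₆ = 3c₁`). [cite: Yu2007, Main Thm (K = ℚ, ℘ = 2); shape only] -/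
theorem y07Two_of_genThreeEngineTwo
    (hE : ∃ (C : ℕ → ℝ) (c₁ : ℝ), 1 ≤ c₁ ∧ (∀ m, 0 ≤ C m ∧ C m ≤ c₁ ^ m) ∧
      ∀ (m : ℕ) (α : Fin m → ℚ) (b : Fin m → ℤ) (V : Fin m → ℝ) (Vmax W : ℝ),
        (∀ j, ∃ a : ℤ, α j = a) →
        (∀ j, 3 ≤ padicValRat 2 (α j - 1)) →
        (∀ μ : Fin m → ℤ, ∏ j, α j ^ μ j = 1 → μ = 0) →
        (∀ κ : Fin m → ℕ, (∃ j, ¬ 3 ∣ κ j) → ∀ γ : ℚ, ∏ j, α j ^ κ j ≠ γ ^ 3) →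
        (∀ j, Height.logHeight₁ (α j) ≤ V j) → (∀ j, 1 ≤ V j) → (∀ j, V j ≤ Vmax) →
        b ≠ 0 → (∀ j, Real.log (max 3 (|b j| : ℝ)) ≤ W) → 1 ≤ W →
        (padicValRat 2 (∏ j, α j ^ b j - 1) : ℝ) ≤ C m * (∏ j, V j) * (W + Real.log (2 * Vmax))) :
    ∃ c₆ : ℝ, ∀ (S : Finset ℕ), (∀ q ∈ S, q.Prime) → 2 ∉ S → S.Nonempty →
      ∀ (e : ℕ → ℤ) (B : ℝ), 3 ≤ B → (∀ q ∈ S, (|e q| : ℝ) ≤ B) →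
      ∏ q ∈ S, (q : ℚ) ^ e q ≠ 1 →
      (padicValRat 2 (∏ q ∈ S, (q : ℚ) ^ e q - 1) : ℝ) * Real.log 2 <
        c₆ ^ S.card * ((2 : ℝ) / Real.log 2) *
          (Real.log 2 + Real.log B + Real.log (Real.log ((max 4 (S.sup id) : ℕ) : ℝ))) *
          ∏ q ∈ S, Real.log (q : ℝ) := by
  classical
  obtain ⟨C, c₁, hc₁, hC, hA⟩ := hE
  refine ⟨3 * c₁, ?_⟩
  intro S hS h2S hSne e B hB heB hne1
  -- enumeration of `S`
  set m : ℕ := S.card with hm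
  have hm1 : 1 ≤ m := Finset.card_pos.mpr hSne
  set φ : Fin m ≃ S := S.equivFin.symm with hφ
  set q : Fin m → ℕ := fun i => (φ i : ℕ) with hqdef
  have hqS : ∀ i, q i ∈ S := fun i => (φ i).2
  have hqP : ∀ i, (q i).Prime := fun i => hS _ (hqS i)
  have hinj : Function.Injective q := fun i j hij => φ.injective (Subtype.ext hij)
  have hq2 : ∀ i, q i ≠ 2 := fun i h => h2S (h ▸ hqS i)
  have hq3 : ∀ i, 3 ≤ q i := fun i => by
    have h2 := (hqP i).two_le; have := hq2 i; omega
  have hreidx : ∀ {M : Type} [CommMonoid M] (f : ℕ → M), ∏ i, f (q i) = ∏ x ∈ S, f x := by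
    intro M _ f
    rw [← Finset.prod_coe_sort S f]
    exact Fintype.prod_equiv φ (fun i => f (q i)) (fun x => f x) (fun i => rfl)
  -- the data fed to the engine
  set M4 : ℝ := ((max 4 (S.sup id) : ℕ) : ℝ) with hM4
  set X : ℝ := Real.log M4 with hX
  set α : Fin m → ℚ := fun j => (q j : ℚ) ^ 2 with hα
  set b : Fin m → ℤ := fun j => e (q j) with hb
  set V : Fin m → ℝ := fun j => 2 * Real.log (q j : ℝ) with hV
  set Vmax : ℝ := 2 * X with hVmax
  set W : ℝ := Real.log B with hW
  have hX1 : (1.38 : ℝ) ≤ X := log_max_four_ge (S.sup id)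
  have hℓ : (0.27 : ℝ) ≤ Real.log X := PadicPrimesYuNinetyRung.loglog_max_four_ge (S.sup id)
  have hX0 : 0 < X := by linarith
  have hlog3 : (1 : ℝ) < Real.log 3 := by
    rw [Real.lt_log_iff_exp_lt (by norm_num)]
    exact Real.exp_one_lt_d9.trans (by norm_num)
  have hlogq : ∀ j, (1 : ℝ) < Real.log (q j : ℝ) := fun j =>
    hlog3.trans_le (Real.log_le_log (by norm_num) (by exact_mod_cast hq3 j))
  -- `W ≥ 1` (`B ≥ 3 > e`)
  have hW1 : 1 ≤ W := hlog3.le.trans (Real.log_le_log (by norm_num) hB)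
  -- the engine's hypotheses
  have h0 : ∀ j, ∃ a : ℤ, α j = a := fun j => ⟨(q j : ℤ) ^ 2, by simp only [hα]; push_cast; ring⟩
  have h1 : ∀ j, 3 ≤ padicValRat 2 (α j - 1) := fun j =>
    three_le_padicValRat_sq_sub_one (hqP j) (hq2 j)
  have h2 : ∀ μ : Fin m → ℤ, ∏ j, α j ^ μ j = 1 → μ = 0 := by
    intro μ hμ
    have hμ' : ∏ j, (q j : ℚ) ^ ((2 : ℤ) * μ j) = 1 := by
      rw [← hμ]
      refine Finset.prod_congr rfl fun j _ => ?_
      simp only [hα]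
      rw [zpow_mul]; norm_cast
    have h0 := Literature.Barriers.ABC.StewartTijdemanGeneric.prime_family_zpow_eq_one hqP hinj hμ'
    funext j
    have := congrFun h0 j
    simp only [Pi.zero_apply, mul_eq_zero, OfNat.ofNat_ne_zero, false_or] at this
    exact this
  have h3 : ∀ κ : Fin m → ℕ, (∃ j, ¬ 3 ∣ κ j) → ∀ γ : ℚ, ∏ j, α j ^ κ j ≠ γ ^ 3 :=
    fun κ hκ γ => (not_cube_prod_sq_primes q hqP hinj κ hκ γ).symm
  have h4 : ∀ j, logHeight₁ (α j) ≤ V j := by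
    intro j
    haveI : NeZero (q j ^ 2) := ⟨pow_ne_zero _ (hqP j).ne_zero⟩
    have hh : logHeight₁ (α j) = 2 * Real.log (q j) := by
      have : α j = ((q j ^ 2 : ℕ) : ℚ) := by simp only [hα]; push_cast; ring
      rw [this, Rat.logHeight₁_natCast (q j ^ 2)]
      push_cast
      rw [Real.log_pow]; norm_num
    rw [hh]
  have h5 : ∀ j, 1 ≤ V j := fun j => by
    show (1 : ℝ) ≤ 2 * Real.log (q j : ℝ)
    linarith [hlogq j]
  have h6 : ∀ j, V j ≤ Vmax := by
    intro j
    have hle : (q j : ℝ) ≤ M4 := by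
      rw [hM4]
      exact_mod_cast (le_max_right 4 (q j)).trans (max_le_max le_rfl (Finset.le_sup (f := id) (hqS j)))
    have hpos : (0 : ℝ) < (q j : ℝ) := by exact_mod_cast (hqP j).pos
    show 2 * Real.log (q j : ℝ) ≤ 2 * X
    linarith [Real.log_le_log hpos hle]
  -- `∏ αⱼ^{bⱼ} = u²`, `u = ∏_{q ∈ S} q^{e_q}`
  set u : ℚ := ∏ x ∈ S, (x : ℚ) ^ e x with hu
  have hprodQ : ∏ j, (q j : ℚ) ^ b j = u := hreidx (fun x => (x : ℚ) ^ e x)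
  have hprodα : ∏ j, α j ^ b j = u ^ 2 := by
    rw [← hprodQ, ← Finset.prod_pow]
    refine Finset.prod_congr rfl fun j _ => ?_
    simp only [hα]
    rw [← zpow_natCast, ← zpow_natCast, ← zpow_mul, ← zpow_mul, mul_comm]
  have h7 : b ≠ 0 := by
    intro h0
    apply hne1
    rw [← hprodQ]
    exact Finset.prod_eq_one fun j _ => by rw [show b j = 0 from congrFun h0 j, zpow_zero]
  have hB0 : 0 < Real.log B := Real.log_pos (by linarith)
  have h8 : ∀ j, Real.log (max 3 (|b j| : ℝ)) ≤ W := by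
    intro j
    have hle : max 3 (|b j| : ℝ) ≤ B := max_le hB (by simp only [hb]; exact heB _ (hqS j))
    exact Real.log_le_log (lt_of_lt_of_le (by norm_num) (le_max_left _ _)) hle
  -- the engine
  have key := hA m α b V Vmax W h0 h1 h2 h3 h4 h5 h6 h7 h8 hW1
  rw [hprodα] at key
  -- `ord₂(u − 1) ≤ ord₂(u² − 1)`
  have hu1 : u - 1 ≠ 0 := sub_ne_zero.mpr hne1
  have hupos : 0 < u := Finset.prod_pos fun x hx => zpow_pos (by exact_mod_cast (hS x hx).pos) _
  have hu1' : u + 1 ≠ 0 := by linarith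
  have hvu : padicValRat 2 u = 0 := by
    rw [hu, Summit.ABC.StewartYu.PrincipalLattice.padicValRat_finset_prod _ _
      fun x hx => zpow_ne_zero _ (by exact_mod_cast (hS x hx).ne_zero)]
    refine Finset.sum_eq_zero fun x hx => ?_
    rw [padicValRat.zpow,
      Literature.Barriers.ABC.StewartTijdemanGeneric.padicValRat_natCast_prime_of_ne Nat.prime_two
        (hS x hx) (fun h => h2S (h ▸ hx))]
    simp
  have hvplus : 0 ≤ padicValRat 2 (u + 1) := by
    have h := padicValRat.min_le_padicValRat_add (p := 2) hu1'
    rw [hvu, padicValRat.one, min_self] at h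
    exact h
  have hvsq : padicValRat 2 (u ^ 2 - 1) = padicValRat 2 (u - 1) + padicValRat 2 (u + 1) := by
    rw [show u ^ 2 - 1 = (u - 1) * (u + 1) by ring, padicValRat.mul hu1 hu1']
  have hvle : (padicValRat 2 (u - 1) : ℝ) ≤ (padicValRat 2 (u ^ 2 - 1) : ℝ) := by
    rw [hvsq]; push_cast
    linarith [(show (0 : ℝ) ≤ (padicValRat 2 (u + 1) : ℝ) by exact_mod_cast hvplus)]
  -- `∏ Vⱼ = 2^m · PL`
  set PL : ℝ := ∏ x ∈ S, Real.log (x : ℝ) with hPL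
  have hPV : ∏ j, V j = 2 ^ m * PL := by
    rw [hPL, ← hreidx (fun x => Real.log (x : ℝ))]
    simp only [hV]
    rw [Finset.prod_mul_distrib, Finset.prod_const, Finset.card_univ, Fintype.card_fin]
  have hPL0 : 0 < PL := by
    rw [hPL, ← hreidx (fun x => Real.log (x : ℝ))]
    exact Finset.prod_pos fun j _ => by linarith [hlogq j]
  have hlX0 : 0 < Real.log X := by linarith
  -- the garbage: `W + log 2Vmax = log B + log 4 + log X ≤ 2·(log 2 + log B + log X)`
  set G : ℝ := Real.log 2 + Real.log B + Real.log X with hG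
  have hl2 := Real.log_two_gt_d9
  have hG0 : 0 < G := by rw [hG]; linarith
  have hl2V : Real.log (2 * Vmax) = 2 * Real.log 2 + Real.log X := by
    rw [hVmax, show (2 : ℝ) * (2 * X) = 2 ^ 2 * X by ring, Real.log_mul (by norm_num) hX0.ne',
      Real.log_pow]; norm_num
  have hgarb : W + Real.log (2 * Vmax) ≤ 2 * G := by rw [hl2V, hG, hW]; linarith
  have hgarb0 : 0 ≤ W + Real.log (2 * Vmax) := by rw [hl2V, hW]; linarith
  -- assemble
  set v : ℝ := (padicValRat 2 (u - 1) : ℝ) with hv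
  have hCm := hC m
  have hstep1 : v * Real.log 2 ≤ C m * (2 ^ m * PL) * (2 * G) * Real.log 2 := by
    have h0 : 0 ≤ C m * (2 ^ m * PL) :=
      mul_nonneg hCm.1 (mul_nonneg (pow_nonneg (by norm_num) m) hPL0.le)
    have hk : v ≤ C m * (2 ^ m * PL) * (2 * G) :=
      calc v ≤ (padicValRat 2 (u ^ 2 - 1) : ℝ) := hvle
        _ ≤ C m * (∏ j, V j) * (W + Real.log (2 * Vmax)) := key
        _ = C m * (2 ^ m * PL) * (W + Real.log (2 * Vmax)) := by rw [hPV]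
        _ ≤ C m * (2 ^ m * PL) * (2 * G) := mul_le_mul_of_nonneg_left hgarb h0
    exact mul_le_mul_of_nonneg_right hk (by linarith)
  have hstep2 : C m * (2 ^ m * PL) * (2 * G) * Real.log 2 ≤
      (c₁ ^ m * 2 ^ m) * (2 * Real.log 2) * (G * PL) := by
    have hr : 0 ≤ (2 ^ m * PL) * (2 * G) * Real.log 2 := by positivity
    calc C m * (2 ^ m * PL) * (2 * G) * Real.log 2 = C m * ((2 ^ m * PL) * (2 * G) * Real.log 2) := by
          ring
      _ ≤ c₁ ^ m * ((2 ^ m * PL) * (2 * G) * Real.log 2) := mul_le_mul_of_nonneg_right hCm.2 hr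
      _ = (c₁ ^ m * 2 ^ m) * (2 * Real.log 2) * (G * PL) := by ring
  have hc0 : 0 < c₁ ^ m := by positivity
  have h23 : c₁ ^ m * (2 : ℝ) ^ m ≤ c₁ ^ m * 3 ^ m :=
    mul_le_mul_of_nonneg_left (pow_le_pow_left₀ (by norm_num) (by norm_num) m) hc0.le
  have hGP : 0 < G * PL := mul_pos hG0 hPL0
  calc v * Real.log 2 ≤ C m * (2 ^ m * PL) * (2 * G) * Real.log 2 := hstep1
    _ ≤ (c₁ ^ m * 2 ^ m) * (2 * Real.log 2) * (G * PL) := hstep2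
    _ < (c₁ ^ m * 3 ^ m) * (2 / Real.log 2) * (G * PL) := by
        have hA : (c₁ ^ m * 2 ^ m) * (2 * Real.log 2) < (c₁ ^ m * 3 ^ m) * (2 / Real.log 2) :=
          calc (c₁ ^ m * 2 ^ m) * (2 * Real.log 2) < (c₁ ^ m * 2 ^ m) * (2 / Real.log 2) :=
                mul_lt_mul_of_pos_left two_mul_log_two_lt_two_div (by positivity)
            _ ≤ (c₁ ^ m * 3 ^ m) * (2 / Real.log 2) :=
                mul_le_mul_of_nonneg_right h23 (div_nonneg (by norm_num) (by linarith))
        exact mul_lt_mul_of_pos_right hA hGP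
    _ = (3 * c₁) ^ m * (2 / Real.log 2) * G * PL := by rw [mul_pow]; ring

end YuOhSeven

end Summit.ABC.StewartYu

end
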